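import Summits.Ventures.PackingBounds.Energy.PolygonPrefixProducts
import Summits.Ventures.PackingBounds.Energy.CircleEnergyLP
import Literature.MathematicalPhysics.QuantumLattice.DiscreteSineTransform

/-!
# The Newton-form certificate of the regular `N`-gon, every `N`: node table, Chebyshev table, design identities

Framing: lottery ticket; floor = certified bounds/negative ranges. Venture `PackingBounds` (cell
`pub-packcert`, seat `pub-packcert-energy`). The data that `NewtonCert.energy_ge_circle` asks for, for the
regular `N`-gon (`m = ⌊N/2⌋` distinct inner products `cos(2πj/N)`, `1 ≤ j ≤ m`), symbolically in `N`:

* nodes in increasing order, doubled: `v_i = 1 - cos ψ_{i mod m}`, `ψ_i = (2i + (N mod 2))π/N` (`node`);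
* the Chebyshev table `G` (`G_table`): for `j ≤ m` the prefix product `∏_{i<j} (t + cos ψ_i)` has the explicit
  nonnegative Chebyshev coefficients of `PolygonPrefixProducts` (`coefP`, sine Gaussian binomials at `x = π/N`);
  for `m < j < 2m` it is the product `P_m · P_{j-m}`, expanded by `2 T_a T_b = T_{a+b} + T_{|a-b|}` (`conv`);
* the design identities `N G_{j,0} = ω_j(2) + Σ_i m_i ω_j(v_i)` (`design`), from `Σ_{l<N} cos(2π c l/N) = 0`,
  `0 < c < N` (`Literature…DiscreteSine`), i.e. the `N`-gon is a spherical `(N-1)`-design.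

## References
* H. Cohn, A. Kumar, *Universally optimal distribution of points on spheres*, J. Amer. Math. Soc. 20 (2007)
  99–148, Thm. 1.2, Table 1 (first row), Thm. 3.1, §5.2. [`CohnKumar2006`]
-/

noncomputable section

namespace Summit.Ventures.PackingBounds.Energy

open Finset Polynomial.Chebyshev

namespace UniversalPolygon

open SineBinomial

/-! ### The nodes of the regular `N`-gon -/

/-- The node angles `ψ_i = (2i + (N mod 2)) π / N`: the inner products of the regular `N`-gon other than `1`
are `-cos ψ_i = cos(2π(m-i)/N)`, `i < m = ⌊N/2⌋`, in increasing order. [cite: CohnKumar2006, Table 1] -/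
def psi (N i : ℕ) : ℝ := (2 * (i : ℝ) + (N % 2 : ℕ)) * Real.pi / N

/-- The doubled node sequence `v_i = 1 - cos ψ_{i mod m}` (`u = 1 + t` coordinates). [cite: CohnKumar2006, §5.2] -/
def node (N i : ℕ) : ℝ := 1 - Real.cos (psi N (i % (N / 2)))

/-- The multiplicity of the node `-cos ψ_i` in the `N`-gon's distance distribution: `1` for the antipode
(`N` even, `i = 0`), else `2`. [cite: CohnKumar2006, Table 1] -/
def mult (N i : ℕ) : ℝ := if N % 2 = 0 ∧ i = 0 then 1 else 2

/-- `0 ≤ v_i`. [folklore] -/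
theorem node_nonneg (N i : ℕ) : 0 ≤ node N i := by
  unfold node; linarith [Real.cos_le_one (psi N (i % (N / 2)))]

/-- Periodicity `v_{m+i} = v_i`. [folklore] -/
theorem node_add (N i : ℕ) : node N (N / 2 + i) = node N i := by
  unfold node; rw [Nat.add_mod_left]

/-- `-cos ψ_i = cos(2π(m-i)/N)` for `i < m`. [folklore] -/
theorem neg_cos_psi (N i : ℕ) (hi : i < N / 2) :
    -Real.cos (psi N i) = Real.cos (2 * Real.pi * ((N / 2 - i : ℕ) : ℝ) / N) := by
  have hN : (N : ℝ) ≠ 0 := by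
    have : 0 < N / 2 := lt_of_le_of_lt (Nat.zero_le _) hi
    exact_mod_cast (show N ≠ 0 by omega)
  rw [← Real.cos_pi_sub]
  congr 1
  unfold psi
  have h2 : ((N / 2 - i : ℕ) : ℝ) = (N / 2 : ℕ) - i := by rw [Nat.cast_sub hi.le]
  have hdm : ((N / 2 : ℕ) : ℝ) * 2 + (N % 2 : ℕ) = N := by exact_mod_cast Nat.div_add_mod' N 2
  rw [h2]
  field_simp
  linarith [hdm]

/-! ### The Chebyshev table of the prefix products -/

/-- The coefficient lists behind `coefP`: sine Gaussian binomials `S(2j, ·)` (`N` odd) or `f(2j-1, ·)` (`N` even)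
at `x = π/N`. [cite: CohnKumar2006, Theorem 3.1] -/
def base (N j r : ℕ) : ℝ :=
  if N % 2 = 1 then sgauss (Real.pi / N) (2 * j) r else fcoef (Real.pi / N) (2 * j - 1) r

/-- The Chebyshev coefficient of `T_c` in the prefix product `P_j(t) = ∏_{i<j} (t + cos ψ_i)`, `j ≤ m`.
[cite: CohnKumar2006, Theorem 3.1] -/
def coefP (N j c : ℕ) : ℝ :=
  if j < c then 0 else base N j (j - c) / 2 ^ (if c = 0 then j else j - 1)

/-- `π/N > 0` and `n · (π/N) < π` for `n < N`. [folklore] -/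
theorem step_facts {N n : ℕ} (hn : n < N) : 0 < Real.pi / N ∧ (n : ℝ) * (Real.pi / N) < Real.pi := by
  have hNr : (0 : ℝ) < N := by exact_mod_cast (lt_of_le_of_lt (Nat.zero_le n) hn)
  refine ⟨div_pos Real.pi_pos hNr, ?_⟩
  rw [mul_div_assoc', div_lt_iff₀ hNr]
  have : (n : ℝ) < N := by exact_mod_cast hn
  nlinarith [Real.pi_pos]

/-- `base ≥ 0` (for `j ≤ m`). [cite: CohnKumar2006, Theorem 3.1] -/
theorem base_nonneg {N j : ℕ} (hN : 0 < N) (hj : j ≤ N / 2) (r : ℕ) : 0 ≤ base N j r := by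
  unfold base
  split_ifs with h
  · obtain ⟨hx, hlt⟩ := step_facts (show 2 * j < N by omega)
    exact sgauss_nonneg hx hlt _
  · obtain ⟨hx, hlt⟩ := step_facts (show 2 * j - 1 < N by omega)
    exact fcoef_nonneg hx hlt _

/-- `coefP ≥ 0` (for `j ≤ m`). [cite: CohnKumar2006, Theorem 3.1] -/
theorem coefP_nonneg {N j : ℕ} (hN : 0 < N) (hj : j ≤ N / 2) (c : ℕ) : 0 ≤ coefP N j c := by
  unfold coefP
  split_ifs
  · exact le_rfl
  · exact div_nonneg (base_nonneg hN hj _) (by positivity)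
  · exact div_nonneg (base_nonneg hN hj _) (by positivity)

/-- **The prefix products as cosine polynomials**: for `j ≤ m`,
`∏_{i<j} (cos θ + cos ψ_i) = Σ_{c ≤ j} coefP_{j,c} cos(cθ)`. [cite: CohnKumar2006, Theorem 3.1] -/
theorem prod_cos_add_cos_psi {N j : ℕ} (hj : j ≤ N / 2) (θ : ℝ) :
    ∏ i ∈ range j, (Real.cos θ + Real.cos (psi N i)) = ∑ c ∈ range (j + 1), coefP N j c * Real.cos (c * θ) := by
  rcases Nat.eq_zero_or_pos j with rfl | hj0
  · simp [coefP, base, sgauss, fcoef]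
  have hN0 : 0 < N := by omega
  have hNr : (0 : ℝ) < N := by exact_mod_cast hN0
  have hx : 0 < Real.pi / N := div_pos Real.pi_pos hNr
  have hlt : ∀ n : ℕ, n < N → (n : ℝ) * (Real.pi / N) < Real.pi := by
    intro n hn
    rw [mul_div_assoc', div_lt_iff₀ hNr]
    have : (n : ℝ) < N := by exact_mod_cast hn
    nlinarith [Real.pi_pos]
  have h2j : (2 : ℝ) ^ j ≠ 0 := pow_ne_zero _ two_ne_zero
  -- the sum side, peeled: `coefP j 0 + Σ_{c<j} coefP j (c+1) cos((c+1)θ)`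
  rw [Finset.sum_range_succ' (fun c => coefP N j c * Real.cos (c * θ))]
  simp only [Nat.cast_zero, zero_mul, Real.cos_zero, mul_one, Nat.cast_succ]
  rcases Nat.mod_two_eq_zero_or_one N with he | ho
  · -- `N` even: `ψ_0 = 0`, `ψ_{i+1} = (2i+2) x`
    obtain ⟨k, rfl⟩ : ∃ k, j = k + 1 := ⟨j - 1, by omega⟩
    have hk : ((2 * k + 1 : ℕ) : ℝ) * (Real.pi / N) < Real.pi := hlt _ (by omega)
    have key := prod_two_cos_even hx k hk θ
    have hpsi0 : Real.cos (psi N 0) = 1 := by simp [psi, he]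
    have hpsi : ∀ i : ℕ, psi N (i + 1) = (2 * (i : ℝ) + 2) * (Real.pi / N) := by
      intro i; simp only [psi, he]; push_cast; ring
    rw [Finset.prod_range_succ' (fun i => Real.cos θ + Real.cos (psi N i)), hpsi0]
    simp_rw [hpsi]
    have hp : ∏ i ∈ range k, (2 * Real.cos θ + 2 * Real.cos ((2 * (i : ℝ) + 2) * (Real.pi / N))) =
        2 ^ k * ∏ i ∈ range k, (Real.cos θ + Real.cos ((2 * (i : ℝ) + 2) * (Real.pi / N))) := by
      rw [show (2 : ℝ) ^ k = ∏ _i ∈ range k, (2 : ℝ) by simp, ← Finset.prod_mul_distrib]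
      exact Finset.prod_congr rfl fun i _ => by ring
    have hL : (2 * Real.cos θ + 2) * ∏ i ∈ range k, (2 * Real.cos θ + 2 * Real.cos ((2 * (i : ℝ) + 2) * (Real.pi / N))) =
        2 ^ (k + 1) * ((∏ i ∈ range k, (Real.cos θ + Real.cos ((2 * (i : ℝ) + 2) * (Real.pi / N)))) *
          (Real.cos θ + 1)) := by
      rw [hp, pow_succ]; ring
    rw [hL] at key
    have key' := congrArg (fun y => y / 2 ^ (k + 1)) key
    rw [mul_div_cancel_left₀ _ (pow_ne_zero _ two_ne_zero)] at key'
    rw [key', add_div, add_comm, Finset.mul_sum, Finset.sum_div]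
    have h2k : 2 * (k + 1) - 1 = 2 * k + 1 := by omega
    congr 1
    · refine Finset.sum_congr rfl fun c hc => ?_
      have hc' := Finset.mem_range.1 hc
      unfold coefP base
      rw [if_neg (by omega), if_neg (by omega), if_neg (by omega), h2k, show k + 1 - (c + 1) = k - c by omega,
        show k + 1 - 1 = k by omega, pow_succ]
      field_simp
    · unfold coefP base
      rw [if_neg (by omega), if_pos rfl, if_neg (by omega), h2k, Nat.sub_zero]
  · -- `N` odd: `ψ_i = (2i+1) x`
    have hk : ((2 * j : ℕ) : ℝ) * (Real.pi / N) < Real.pi := hlt _ (by omega)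
    have key := prod_two_cos_odd hx j hk θ
    have hpsi : ∀ i : ℕ, psi N i = (2 * (i : ℝ) + 1) * (Real.pi / N) := by
      intro i; simp only [psi, ho]; push_cast; ring
    simp_rw [hpsi]
    have hL : ∏ i ∈ range j, (2 * Real.cos θ + 2 * Real.cos ((2 * (i : ℝ) + 1) * (Real.pi / N))) =
        2 ^ j * ∏ i ∈ range j, (Real.cos θ + Real.cos ((2 * (i : ℝ) + 1) * (Real.pi / N))) := by
      rw [show (2 : ℝ) ^ j = ∏ _i ∈ range j, (2 : ℝ) by simp, ← Finset.prod_mul_distrib]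
      exact Finset.prod_congr rfl fun i _ => by ring
    rw [hL] at key
    have key' := congrArg (fun y => y / 2 ^ j) key
    rw [mul_div_cancel_left₀ _ h2j] at key'
    rw [key', add_div, add_comm, Finset.mul_sum, Finset.sum_div]
    obtain ⟨k, rfl⟩ : ∃ k, j = k + 1 := ⟨j - 1, by omega⟩
    congr 1
    · refine Finset.sum_congr rfl fun c hc => ?_
      have hc' := Finset.mem_range.1 hc
      unfold coefP base
      rw [if_neg (by omega), if_pos ho, if_neg (by omega), show k + 1 - (c + 1) = k - c by omega,
        show k + 1 - 1 - c = k - c by omega, show k + 1 - 1 = k by omega, pow_succ]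
      field_simp
    · unfold coefP base
      rw [if_neg (by omega), if_pos rfl, if_pos ho, Nat.sub_zero]

/-! ### The full table `G` (partial products `ω_j`, `j < 2m`) -/

/-- `conv` vanishes beyond the total degree. [folklore] -/
theorem conv_eq_zero {A B : ℕ → ℝ} {dA dB c : ℕ} (hc : dA + dB < c) : conv A B dA dB c = 0 := by
  unfold conv
  refine Finset.sum_eq_zero fun a ha => Finset.sum_eq_zero fun b hb => ?_
  have ha' := Finset.mem_range.1 ha
  have hb' := Finset.mem_range.1 hb
  rw [if_neg (by omega), if_neg (by omega)]; ring

/-- `coefP_{j,c} = 0` for `c > j`. [folklore] -/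
theorem coefP_eq_zero {N j c : ℕ} (hc : j < c) : coefP N j c = 0 := by
  unfold coefP; rw [if_pos hc]

/-- The Chebyshev table of the Newton partial products of the doubled node sequence:
`ω_j(1+t) = Σ_c G_{j,c} T_c(t)` — `coefP_j` for `j ≤ m`, the product `P_m P_{j-m}` for `m < j < 2m`, `0` beyond.
[cite: CohnKumar2006, §5.2] -/
def G (N j c : ℕ) : ℝ :=
  if j ≤ N / 2 then coefP N j c
  else if j < N / 2 + N / 2 then conv (coefP N (N / 2)) (coefP N (j - N / 2)) (N / 2) (j - N / 2) c else 0

/-- `G ≥ 0`. [cite: CohnKumar2006, Theorem 3.1 and §5.2] -/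
theorem G_nonneg {N : ℕ} (hN : 0 < N) (j c : ℕ) : 0 ≤ G N j c := by
  unfold G
  split_ifs with h1 h2
  · exact coefP_nonneg hN h1 c
  · exact conv_nonneg (coefP_nonneg hN le_rfl) (coefP_nonneg hN (by omega)) _ _ _
  · exact le_rfl

/-- **The partial products as cosine polynomials**, all `j < 2m`. [cite: CohnKumar2006, §5.2] -/
theorem omega_cos {N j : ℕ} (hj : j < N / 2 + N / 2) (θ : ℝ) :
    ∏ i ∈ range j, (Real.cos θ + Real.cos (psi N (i % (N / 2)))) =
      ∑ c ∈ range (N / 2 + N / 2), G N j c * Real.cos (c * θ) := by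
  by_cases hjm : j ≤ N / 2
  · have hG : ∀ c, G N j c = coefP N j c := fun c => by unfold G; rw [if_pos hjm]
    simp_rw [hG]
    rw [Finset.prod_congr rfl fun i hi => by
      rw [Nat.mod_eq_of_lt (lt_of_lt_of_le (Finset.mem_range.1 hi) hjm)], prod_cos_add_cos_psi hjm θ]
    exact Finset.sum_subset (Finset.range_subset_range.2 (by omega)) fun c hc hc' => by
      rw [coefP_eq_zero (by have := Finset.mem_range.1 hc; rw [Finset.mem_range] at hc'; omega), zero_mul]
  · obtain ⟨d, rfl⟩ : ∃ d, j = N / 2 + d := ⟨j - N / 2, by omega⟩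
    have hd : d ≤ N / 2 := by omega
    have hG : ∀ c, G N (N / 2 + d) c = conv (coefP N (N / 2)) (coefP N d) (N / 2) d c := by
      intro c; unfold G; rw [if_neg hjm, if_pos hj, Nat.add_sub_cancel_left]
    simp_rw [hG]
    rw [Finset.prod_range_add, Finset.prod_congr rfl fun i hi => by rw [Nat.mod_eq_of_lt (Finset.mem_range.1 hi)],
      prod_cos_add_cos_psi le_rfl θ,
      Finset.prod_congr rfl fun i hi => by
        rw [Nat.add_mod_left, Nat.mod_eq_of_lt (by have := Finset.mem_range.1 hi; omega)],
      prod_cos_add_cos_psi hd θ, cos_sum_mul_cos_sum]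
    exact Finset.sum_subset (Finset.range_subset_range.2 (by omega)) fun c hc hc' => by
      rw [conv_eq_zero (by have := Finset.mem_range.1 hc; rw [Finset.mem_range] at hc'; omega), zero_mul]

/-- **The Chebyshev table identity** `∏_{i<j} (1 + t - v_i) = Σ_{c<2m} G_{j,c} T_c(t)` for all real `t`
(`j < 2m`): the cosine identity on `[-1,1]`, extended by polynomial extensionality. [cite: CohnKumar2006, §5.2] -/
theorem omega_eq {N j : ℕ} (hj : j < N / 2 + N / 2) (t : ℝ) :
    ∏ i ∈ range j, (1 + t - node N i) = ∑ c ∈ range (N / 2 + N / 2), G N j c * (T ℝ c).eval t := by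
  set p : Polynomial ℝ := ∏ i ∈ range j, (Polynomial.X + Polynomial.C (Real.cos (psi N (i % (N / 2))))) with hp
  set q : Polynomial ℝ := ∑ c ∈ range (N / 2 + N / 2), Polynomial.C (G N j c) * T ℝ c with hq
  have hpe : ∀ s : ℝ, p.eval s = ∏ i ∈ range j, (s + Real.cos (psi N (i % (N / 2)))) := by
    intro s; simp [hp, Polynomial.eval_prod]
  have hqe : ∀ s : ℝ, q.eval s = ∑ c ∈ range (N / 2 + N / 2), G N j c * (T ℝ c).eval s := by
    intro s; simp [hq, Polynomial.eval_finsetSum]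
  have hpq : p = q := by
    refine Polynomial.eq_of_infinite_eval_eq p q (Set.Infinite.mono (fun s hs => ?_)
      (Set.Icc_infinite (show (-1 : ℝ) < 1 by norm_num)))
    obtain ⟨hs1, hs2⟩ := hs
    rw [Set.mem_setOf_eq, ← Real.cos_arccos hs1 hs2, hpe, hqe, omega_cos hj]
    refine Finset.sum_congr rfl fun c _ => ?_
    rw [T_real_cos]; push_cast; ring_nf
  have h1 : ∏ i ∈ range j, (1 + t - node N i) = p.eval t := by
    rw [hpe]; exact Finset.prod_congr rfl fun i _ => by unfold node; ring
  rw [h1, hpq, hqe]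

/-! ### The design identities -/

/-- `Σ_{l<N} T_c(cos(2πl/N)) = N` for `c = 0` and `= 0` for `0 < c < N`: the `N`-gon is an `(N-1)`-design.
[folklore] -/
theorem sum_T_cos (N c : ℕ) (hc : c < N) :
    ∑ l ∈ range N, (T ℝ c).eval (Real.cos (2 * Real.pi * l / N)) = if c = 0 then (N : ℝ) else 0 := by
  split_ifs with h
  · subst h; simp
  · rw [← Literature.MathematicalPhysics.QuantumLattice.DiscreteSine.sum_range_cos_two_pi_mul_div_eq_zero
      (Nat.pos_of_ne_zero h) hc]
    refine Finset.sum_congr rfl fun l _ => ?_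
    rw [T_real_cos]; push_cast; ring_nf

/-- Regrouping a sum over the `N`-gon's angles by inner product: `Σ_{l<N} g(cos(2πl/N)) =
g(1) + Σ_{i<m} mult_i g(cos(2π(m-i)/N))`. [folklore] -/
theorem regroup {N : ℕ} (hN : 2 ≤ N) (g : ℝ → ℝ) :
    ∑ l ∈ range N, g (Real.cos (2 * Real.pi * l / N)) =
      g 1 + ∑ i ∈ range (N / 2), mult N i * g (Real.cos (2 * Real.pi * ((N / 2 - i : ℕ) : ℝ) / N)) := by
  have hNr : (N : ℝ) ≠ 0 := by exact_mod_cast (show N ≠ 0 by omega)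
  have hcosN : ∀ a b : ℕ, a + b = N → g (Real.cos (2 * Real.pi * a / N)) = g (Real.cos (2 * Real.pi * b / N)) := by
    intro a b hab
    have ha : (a : ℝ) = N - b := by rw [← hab]; push_cast; ring
    have : (2 * Real.pi * a / N : ℝ) = 2 * Real.pi - 2 * Real.pi * b / N := by
      rw [ha]; field_simp
    rw [this, Real.cos_two_pi_sub]
  -- the first `m + 1` angles: `l = 0` and `l = m - i`, `i < m`
  have hfirst : ∑ l ∈ range (N / 2 + 1), g (Real.cos (2 * Real.pi * l / N)) =
      g 1 + ∑ i ∈ range (N / 2), g (Real.cos (2 * Real.pi * ((N / 2 - i : ℕ) : ℝ) / N)) := by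
    rw [Finset.sum_range_succ', ← Finset.sum_range_reflect _ (N / 2)]
    simp only [Nat.cast_zero, mul_zero, zero_div, Real.cos_zero, add_comm (g 1)]
    congr 1
    exact Finset.sum_congr rfl fun i hi => by
      rw [show N / 2 - 1 - i + 1 = N / 2 - i by have := Finset.mem_range.1 hi; omega]
  rcases Nat.mod_two_eq_zero_or_one N with he | ho
  · -- `N = 2m`: the remaining `m - 1` angles `l = m + 1 + i` pair with `m - 1 - i`
    have hsplit : range N = range ((N / 2 + 1) + (N / 2 - 1)) := by congr 1; omega
    rw [hsplit, Finset.sum_range_add, hfirst, add_assoc]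
    congr 1
    obtain ⟨m', hm'⟩ : ∃ m', N / 2 = m' + 1 := ⟨N / 2 - 1, by omega⟩
    rw [hm', Nat.add_sub_cancel, Finset.sum_range_succ', Finset.sum_range_succ']
    have hmult0 : mult N 0 = 1 := by simp [mult, he]
    have hmult : ∀ i, mult N (i + 1) = 2 := fun i => by simp [mult]
    have hB : ∑ x ∈ range m', g (Real.cos (2 * Real.pi * ((m' + 1 + 1 + x : ℕ) : ℝ) / N)) =
        ∑ k ∈ range m', g (Real.cos (2 * Real.pi * ((m' + 1 - (k + 1) : ℕ) : ℝ) / N)) :=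
      Finset.sum_congr rfl fun x hx => hcosN _ _ (by have := Finset.mem_range.1 hx; omega)
    have hR : ∑ k ∈ range m', mult N (k + 1) * g (Real.cos (2 * Real.pi * ((m' + 1 - (k + 1) : ℕ) : ℝ) / N)) =
        2 * ∑ k ∈ range m', g (Real.cos (2 * Real.pi * ((m' + 1 - (k + 1) : ℕ) : ℝ) / N)) := by
      rw [Finset.mul_sum]; exact Finset.sum_congr rfl fun k _ => by rw [hmult]
    rw [hB, hR, hmult0]; ring
  · -- `N = 2m+1`: the remaining `m` angles `l = m + 1 + i` pair with `m - i`
    have hsplit : range N = range ((N / 2 + 1) + N / 2) := by congr 1; omega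
    rw [hsplit, Finset.sum_range_add, hfirst, add_assoc]
    congr 1
    rw [← Finset.sum_add_distrib]
    refine Finset.sum_congr rfl fun i hi => ?_
    have hi' := Finset.mem_range.1 hi
    have hmult : mult N i = 2 := by simp [mult, ho]
    rw [hmult, hcosN (N / 2 + 1 + i) (N / 2 - i) (by omega)]
    ring

/-- **The design identities** `N G_{j,0} = ω_j(2) + Σ_{i<m} mult_i ω_j(v_i)`, `j < 2m`. [cite: CohnKumar2006, §5.2] -/
theorem design {N : ℕ} (hN : 2 ≤ N) {j : ℕ} (hj : j < N / 2 + N / 2) :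
    (N : ℝ) * G N j 0 =
      ∏ i ∈ range j, (2 - node N i) + ∑ i ∈ range (N / 2), mult N i * ∏ i' ∈ range j, (node N i - node N i') := by
  -- evaluate the table identity at `t = 1` and at `t = v_i - 1 = cos(2π(m-i)/N)`
  have h2 : ∏ i ∈ range j, (2 - node N i) = ∑ c ∈ range (N / 2 + N / 2), G N j c * (T ℝ c).eval 1 := by
    rw [← omega_eq hj 1]; exact Finset.prod_congr rfl fun i _ => by ring
  have hv : ∀ i ∈ range (N / 2), ∏ i' ∈ range j, (node N i - node N i') =
      ∑ c ∈ range (N / 2 + N / 2), G N j c * (T ℝ c).eval (Real.cos (2 * Real.pi * ((N / 2 - i : ℕ) : ℝ) / N)) := by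
    intro i hi
    rw [← neg_cos_psi N i (Finset.mem_range.1 hi), ← omega_eq hj]
    refine Finset.prod_congr rfl fun i' _ => ?_
    rw [node, node, Nat.mod_eq_of_lt (Finset.mem_range.1 hi)]; ring
  have hS : ∀ c ∈ range (N / 2 + N / 2), (T ℝ c).eval 1 + ∑ i ∈ range (N / 2),
      mult N i * (T ℝ c).eval (Real.cos (2 * Real.pi * ((N / 2 - i : ℕ) : ℝ) / N)) = if c = 0 then (N : ℝ) else 0 := by
    intro c hc
    rw [← sum_T_cos N c (by have := Finset.mem_range.1 hc; omega), regroup hN (fun s => (T ℝ c).eval s)]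
  calc (N : ℝ) * G N j 0 = ∑ c ∈ range (N / 2 + N / 2), G N j c * (if c = 0 then (N : ℝ) else 0) := by
        simp only [mul_ite, mul_zero]
        rw [Finset.sum_ite_eq', if_pos (Finset.mem_range.2 (by omega))]; ring
    _ = ∑ c ∈ range (N / 2 + N / 2), G N j c * ((T ℝ c).eval 1 + ∑ i ∈ range (N / 2),
          mult N i * (T ℝ c).eval (Real.cos (2 * Real.pi * ((N / 2 - i : ℕ) : ℝ) / N))) :=
        Finset.sum_congr rfl fun c hc => by rw [hS c hc]
    _ = ∑ c ∈ range (N / 2 + N / 2), G N j c * (T ℝ c).eval 1 +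
          ∑ i ∈ range (N / 2), mult N i * ∑ c ∈ range (N / 2 + N / 2),
            G N j c * (T ℝ c).eval (Real.cos (2 * Real.pi * ((N / 2 - i : ℕ) : ℝ) / N)) := by
        rw [Finset.sum_congr rfl fun c _ => mul_add _ _ _, Finset.sum_add_distrib]
        congr 1
        simp_rw [Finset.mul_sum]
        rw [Finset.sum_comm]
        exact Finset.sum_congr rfl fun i _ => Finset.sum_congr rfl fun c _ => by ring
    _ = _ := by
        rw [h2]
        congr 1
        exact Finset.sum_congr rfl fun i hi => by rw [hv i hi]

end UniversalPolygon

end Summit.Ventures.PackingBounds.Energy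

end
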